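import Summits.MatrixMultiplication.MatrixMultiplication.Theorems.ThinPackings.Negative.CoordinateFrameNoExcess

/-!
# The volume capacity of coordinate frame families (crux `ThinPackings`, stmt-MatrixMultiplication-10595)

Lead c2 (line `three-sphere-frame-designs`, 2026-08-16).  A COORDINATE frame family is a box family
`A B C : Fin L → Finset (ℤ^D)` in `[-b,b]^D` whose three legs in each block are supported on pairwise disjoint
coordinate sets `SA i, SB i, SC i` (so they are pairwise orthogonal), with the three weak packings.  Every
calibration family produced on this crux (USP/CKSU-Theorem-33 type, graded, common-leg; leads 0, c1, a1, the
drefuter) is of this kind, and all of them sit at slack `η = a + o(1)`.  This file explains why, sharply: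

* `coordFrames_volume_le_param` (registered stub): for all reals `0 < y ≤ x` with `x·y² ≥ 2b+1`,
  `Σᵢ |Aᵢ||Bᵢ||Cᵢ| ≤ (x + 2b·y)^D`.
  (a1's tensor-stable certificate `volume_le_pow_of_coordPrice` with the three-valued coordinatewise price
  `w(0) = x`, `w(u) = y` for `0 < |u| ≤ b`, `w(u) = 0` for `b < |u| ≤ 2b` — coordinate tiles never use the far
  values; the cubic block inequality holds because a tile of a coordinate block vanishes off `SA ∪ SC`, so it costs
  `≥ x^{D−sA−sC} y^{sA+sC}`, and `|A||B||C| ≤ (2b+1)^{sA+sB+sC} ≤ (x y²)^{sA+sB+sC}`.)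
* `coordFrames_volume_le_four` (`x = 2b+1`, `y = 1`): `Σ ≤ (4b+1)^D` — coordinate frames never even fill the TILE box,
  let alone the carry-free host `(6b+1)^D`: `FrameNoExcess` for coordinate frames with room to spare.
* `coordFrames_volume_le_sharp` (`y = 5/4`, `x = 16(2b+1)/25`, `b ≥ 1`): `Σ ≤ (189 b/50 + 16/25)^D = (3.78 b + 0.64)^D`; the
  exact optimum of `(2b+1)/y² + 2by` is `3·b^{2/3}(2b+1)^{1/3} ∼ 3·2^{1/3}·b = (3/2^{2/3})·2b`, which is the CKSU USP
  capacity times the leg alphabet `2b`: Theorem-33-type families (`(3/2^{2/3})^{D}·(2b)^D` up to `D^{O(1)}`) are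
  OPTIMAL among coordinate frames.  In particular coordinate designs exist at NO `(a, η)` with `η < a`, in any box.
Elementary and sorry-free.
-/

set_option linter.dupNamespace false  -- `Summit.<S>.<S>.…` is the mandated namespace

namespace Summit.MatrixMultiplication.MatrixMultiplication.Theorems.ThinPackings.Negative

open Finset

section CoordCapacity

variable {D L : ℕ}

/-- The three-valued coordinate price: `x` at `0`, `y` on `1 ≤ |u| ≤ b`, `0` beyond. [new, elementary] -/
noncomputable def coordPriceParam (b : ℕ) (x y : ℝ) (u : ℕ) : ℝ :=
  if u = 0 then x else if u ≤ b then y else 0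

/-- Price of a coordinate tile: if `v` vanishes off `S` and has entries in `[-b,b]`, then
`coordPrice w v ≥ x^{D−|S|}·y^{|S|}` for the three-valued price with `0 < y ≤ x`. [new, elementary] -/
theorem pow_mul_pow_le_coordPrice {b : ℕ} {x y : ℝ} (hy : 0 < y) (hyx : y ≤ x) (v : Fin D → ℤ)
    (S : Finset (Fin D)) (hsupp : ∀ t ∉ S, v t = 0) (hbox : ∀ t, |v t| ≤ (b : ℤ)) :
    x ^ (D - S.card) * y ^ S.card ≤ coordPrice (coordPriceParam b x y) v := by
  classical
  unfold coordPrice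
  have hpt : ∀ t, (if t ∈ S then y else x) ≤ coordPriceParam b x y (v t).natAbs := by
    intro t
    unfold coordPriceParam
    by_cases ht : t ∈ S
    · rw [if_pos ht]
      have hb : (v t).natAbs ≤ b := by
        have := hbox t; rw [abs_le] at this; omega
      by_cases h0 : (v t).natAbs = 0
      · rw [if_pos h0]; exact hyx
      · rw [if_neg h0, if_pos hb]
    · rw [if_neg ht, hsupp t ht]; simp
  have hfun : (fun t : Fin D => if t ∈ S then y else x) =
      fun t => (if t ∈ S then y else 1) * (if t ∈ Sᶜ then x else 1) := by
    funext t; by_cases ht : t ∈ S <;> simp [ht]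
  calc x ^ (D - S.card) * y ^ S.card = ∏ t, (if t ∈ S then y else x) := by
        rw [hfun, prod_mul_distrib, Fintype.prod_ite_mem, Fintype.prod_ite_mem, prod_const, prod_const,
          card_compl, Fintype.card_fin, mul_comm]
    _ ≤ ∏ t, coordPriceParam b x y (v t).natAbs :=
        prod_le_prod (fun t _ => by split_ifs <;> linarith) fun t _ => hpt t

/-- The budget of the three-valued price over the tile alphabet `[-2b, 2b]`: `x + 2b·y`. [new, elementary] -/
theorem sum_coordPriceParam_Icc (b : ℕ) (x y : ℝ) :
    ∑ u ∈ Icc (-(2 * b : ℤ)) (2 * b), coordPriceParam b x y u.natAbs = x + 2 * b * y := by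
  classical
  have hsplit : ∀ u : ℤ, coordPriceParam b x y u.natAbs =
      (if u = 0 then x else 0) + (if u ∈ (Icc (-(b : ℤ)) b).erase 0 then y else 0) := by
    intro u
    unfold coordPriceParam
    by_cases h0 : u = 0
    · subst h0; simp
    · have h0' : u.natAbs ≠ 0 := by rwa [Ne, Int.natAbs_eq_zero]
      rw [if_neg h0', if_neg h0, zero_add]
      by_cases hb : u.natAbs ≤ b
      · rw [if_pos hb, if_pos]
        rw [mem_erase, mem_Icc]; refine ⟨h0, ?_, ?_⟩ <;> omega
      · rw [if_neg hb, if_neg]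
        rw [mem_erase, mem_Icc]; omega
  rw [Finset.sum_congr rfl fun u _ => hsplit u, sum_add_distrib, sum_ite_eq' (Icc (-(2 * b : ℤ)) (2 * b)) 0,
    if_pos (by rw [mem_Icc]; omega), ← Finset.sum_filter]
  have hfilter : (Icc (-(2 * b : ℤ)) (2 * b)).filter (fun u => u ∈ (Icc (-(b : ℤ)) b).erase 0) =
      (Icc (-(b : ℤ)) b).erase 0 := by
    ext u; simp only [mem_filter, mem_erase, mem_Icc]; omega
  rw [hfilter, sum_const, nsmul_eq_mul]
  have hcard : ((Icc (-(b : ℤ)) b).erase 0).card = 2 * b := by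
    rw [card_erase_of_mem (by rw [mem_Icc]; omega), Int.card_Icc]; omega
  rw [hcard]; push_cast; ring

/-- Exponent bookkeeping for the cubic block inequality: with `s = sA+sB+sC ≤ D`, `x ≥ 1`, `y ≥ 0`,
`(x y²)^s ≤ (x^{D−(sA+sC)} y^{sA+sC})(x^{D−(sA+sB)} y^{sA+sB})(x^{D−(sC+sB)} y^{sC+sB})`. [new, elementary] -/
theorem capacity_exponent_bookkeeping {x y : ℝ} (hx1 : 1 ≤ x) (_hy : 0 ≤ y) {D sA sB sC : ℕ}
    (hs : sA + sB + sC ≤ D) :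
    (x * y ^ 2) ^ (sA + sB + sC) ≤
      (x ^ (D - (sA + sC)) * y ^ (sA + sC)) * (x ^ (D - (sA + sB)) * y ^ (sA + sB)) *
        (x ^ (D - (sC + sB)) * y ^ (sC + sB)) := by
  have hysum : y ^ (sA + sC) * y ^ (sA + sB) * y ^ (sC + sB) = (y ^ 2) ^ (sA + sB + sC) := by
    rw [← pow_add, ← pow_add, ← pow_mul]; congr 1; omega
  have hxsum : x ^ (sA + sB + sC) ≤ x ^ (D - (sA + sC)) * x ^ (D - (sA + sB)) * x ^ (D - (sC + sB)) := by
    rw [← pow_add, ← pow_add]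
    exact pow_le_pow_right₀ hx1 (by omega)
  calc (x * y ^ 2) ^ (sA + sB + sC) = x ^ (sA + sB + sC) * (y ^ 2) ^ (sA + sB + sC) := mul_pow _ _ _
    _ ≤ (x ^ (D - (sA + sC)) * x ^ (D - (sA + sB)) * x ^ (D - (sC + sB))) *
          (y ^ (sA + sC) * y ^ (sA + sB) * y ^ (sC + sB)) := by
        rw [hysum]; exact mul_le_mul_of_nonneg_right hxsum (by positivity)
    _ = _ := by ring

/-- The cubic step: `V ≤ kT·kE·kF` and the three pair bounds `a·c·kT ≤ T`, `a·b·kE ≤ E`, `c·b·kF ≤ F` give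
`V³ ≤ T·E·F` when `V = a·b·c`. [new, elementary] -/
theorem capacity_cube_step {V a bb c kT kE kF T E F : ℝ} (ha : 0 ≤ a) (hb : 0 ≤ bb) (hc : 0 ≤ c)
    (_hkT : 0 ≤ kT) (_hkE : 0 ≤ kE) (_hkF : 0 ≤ kF) (hV : V = a * bb * c) (hcap : V ≤ kT * kE * kF)
    (hT : a * c * kT ≤ T) (hE : a * bb * kE ≤ E) (hF : c * bb * kF ≤ F) (hTnn : 0 ≤ T) (hEnn : 0 ≤ E) :
    V ^ 3 ≤ T * E * F := by
  have hVnn : 0 ≤ V := by rw [hV]; positivity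
  calc V ^ 3 = V ^ 2 * V := by ring
    _ ≤ V ^ 2 * (kT * kE * kF) := by gcongr
    _ = (a * c * kT) * (a * bb * kE) * (c * bb * kF) := by rw [hV]; ring
    _ ≤ T * E * F := mul_le_mul (mul_le_mul hT hE (by positivity) hTnn) hF (by positivity) (mul_nonneg hTnn hEnn)

/-- **Coordinate frame capacity, parametric form** (registered stub `coordFrames_volume_le_param`).  For a
coordinate frame family in `[-b,b]^D` with the three weak packings and any reals `0 < y ≤ x` with `x·y² ≥ 2b+1`:
`Σᵢ |Aᵢ||Bᵢ||Cᵢ| ≤ (x + 2b·y)^D`. [new, elementary] -/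
theorem coordFrames_volume_le_param :
    ∀ (D L b : ℕ) (x y : ℝ) (A B C : Fin L → Finset (Fin D → ℤ)) (SA SB SC : Fin L → Finset (Fin D)),
      0 < y → y ≤ x → ((2 * b + 1 : ℕ) : ℝ) ≤ x * y ^ 2 →
      (∀ i, Disjoint (SA i) (SB i) ∧ Disjoint (SA i) (SC i) ∧ Disjoint (SB i) (SC i)) →
      (∀ i, (∀ v ∈ A i, ∀ t ∉ SA i, v t = 0) ∧ (∀ v ∈ B i, ∀ t ∉ SB i, v t = 0) ∧
        (∀ v ∈ C i, ∀ t ∉ SC i, v t = 0)) →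
      (∀ i, (∀ v ∈ A i, ∀ t, |v t| ≤ (b : ℤ)) ∧ (∀ v ∈ B i, ∀ t, |v t| ≤ (b : ℤ)) ∧
        (∀ v ∈ C i, ∀ t, |v t| ≤ (b : ℤ))) →
      (∀ i k, ∀ x ∈ A i, ∀ z ∈ C i, ∀ x' ∈ A k, ∀ z' ∈ C k, z - x = z' - x' → i = k) →
      (∀ i k, ∀ x ∈ A i, ∀ y ∈ B i, ∀ x' ∈ A k, ∀ y' ∈ B k, y - x = y' - x' → i = k) →
      (∀ i k, ∀ y ∈ B i, ∀ z ∈ C i, ∀ y' ∈ B k, ∀ z' ∈ C k, y - z = y' - z' → i = k) →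
      ((∑ i, (A i).card * (B i).card * (C i).card : ℕ) : ℝ) ≤ (x + 2 * b * y) ^ D := by
  intro D L b x y A B C SA SB SC hy hyx hxy hdisj hsupp hbox hPD hPE hPF
  classical
  have hx : 0 < x := lt_of_lt_of_le hy hyx
  -- `x ≥ 1` (from `x³ ≥ x y² ≥ 2b+1 ≥ 1`)
  have hx1 : 1 ≤ x := by
    by_contra hlt
    have hlt : x < 1 := lt_of_not_ge hlt
    have h1 : x * y ^ 2 < 1 := by
      have hy1 : y < 1 := lt_of_le_of_lt hyx hlt
      have : y ^ 2 < 1 := by nlinarith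
      nlinarith
    have h2 : (1 : ℝ) ≤ ((2 * b + 1 : ℕ) : ℝ) := by exact_mod_cast (by omega : 1 ≤ 2 * b + 1)
    linarith
  set w := coordPriceParam b x y with hw_def
  have hw : ∀ u, 0 ≤ w u := by
    intro u; rw [hw_def]; unfold coordPriceParam; split_ifs <;> linarith
  -- pairwise orthogonality from disjoint supports
  have horth : ∀ (X Y : Finset (Fin D → ℤ)) (S T : Finset (Fin D)), Disjoint S T →
      (∀ v ∈ X, ∀ t ∉ S, v t = 0) → (∀ v ∈ Y, ∀ t ∉ T, v t = 0) →
      ∀ u ∈ X, ∀ v ∈ Y, u ⬝ᵥ v = 0 := by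
    intro X Y S T hST hX hY u hu v hv
    unfold dotProduct
    refine Finset.sum_eq_zero fun t _ => ?_
    by_cases ht : t ∈ S
    · rw [hY v hv t (Finset.disjoint_left.1 hST ht), mul_zero]
    · rw [hX u hu t ht, zero_mul]
  have hoAB : ∀ i, ∀ u ∈ A i, ∀ v ∈ B i, u ⬝ᵥ v = 0 := fun i =>
    horth (A i) (B i) (SA i) (SB i) (hdisj i).1 (hsupp i).1 (hsupp i).2.1
  have hoAC : ∀ i, ∀ u ∈ A i, ∀ v ∈ C i, u ⬝ᵥ v = 0 := fun i =>
    horth (A i) (C i) (SA i) (SC i) (hdisj i).2.1 (hsupp i).1 (hsupp i).2.2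
  have hoBC : ∀ i, ∀ u ∈ B i, ∀ v ∈ C i, u ⬝ᵥ v = 0 := fun i =>
    horth (B i) (C i) (SB i) (SC i) (hdisj i).2.2 (hsupp i).2.1 (hsupp i).2.2
  -- a double sum of tile prices over two coordinate legs
  have hpair : ∀ (X Z : Finset (Fin D → ℤ)) (S T : Finset (Fin D)),
      (∀ v ∈ X, ∀ t ∉ S, v t = 0) → (∀ v ∈ Z, ∀ t ∉ T, v t = 0) →
      (∀ v ∈ X, ∀ t, |v t| ≤ (b : ℤ)) → (∀ v ∈ Z, ∀ t, |v t| ≤ (b : ℤ)) → Disjoint S T →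
      (X.card : ℝ) * Z.card * (x ^ (D - (S.card + T.card)) * y ^ (S.card + T.card)) ≤
        ∑ u ∈ X, ∑ v ∈ Z, coordPrice w (v - u) := by
    intro X Z S T hX hZ hbX hbZ hST
    have hle : ∀ u ∈ X, ∀ v ∈ Z,
        x ^ (D - (S.card + T.card)) * y ^ (S.card + T.card) ≤ coordPrice w (v - u) := by
      intro u hu v hv
      have hcardU : (S ∪ T).card = S.card + T.card := card_union_of_disjoint hST
      rw [← hcardU, hw_def]
      refine pow_mul_pow_le_coordPrice hy hyx (v - u) (S ∪ T) (fun t ht => ?_) fun t => ?_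
      · simp only [mem_union, not_or] at ht
        rw [Pi.sub_apply, hX u hu t ht.1, hZ v hv t ht.2, sub_zero]
      · -- a coordinate of `v - u` is `v t` or `-u t` (disjoint supports), so it lies in `[-b, b]`
        rw [Pi.sub_apply]
        by_cases ht : t ∈ S
        · rw [hZ v hv t (Finset.disjoint_left.1 hST ht), zero_sub, abs_neg]; exact hbX u hu t
        · rw [hX u hu t ht, sub_zero]; exact hbZ v hv t
    calc (X.card : ℝ) * Z.card * (x ^ (D - (S.card + T.card)) * y ^ (S.card + T.card))
        = ∑ _u ∈ X, ∑ _v ∈ Z, x ^ (D - (S.card + T.card)) * y ^ (S.card + T.card) := by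
          rw [sum_const, sum_const, nsmul_eq_mul, nsmul_eq_mul]; ring
      _ ≤ ∑ u ∈ X, ∑ v ∈ Z, coordPrice w (v - u) :=
          sum_le_sum fun u hu => sum_le_sum fun v hv => hle u hu v hv
  -- the cubic block inequality
  have hgeo : ∀ i, (((A i).card * (B i).card * (C i).card : ℕ) : ℝ) ^ 3 ≤
      (∑ u ∈ A i, ∑ v ∈ C i, coordPrice w (v - u)) * (∑ u ∈ A i, ∑ v ∈ B i, coordPrice w (v - u)) *
        ∑ u ∈ C i, ∑ v ∈ B i, coordPrice w (v - u) := by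
    intro i
    obtain ⟨hdAB, hdAC, hdBC⟩ := hdisj i
    obtain ⟨hsA, hsB, hsC⟩ := hsupp i
    obtain ⟨hbA, hbB, hbC⟩ := hbox i
    have hs : (SA i).card + (SB i).card + (SC i).card ≤ D := by
      have h3 : (SA i ∪ SB i ∪ SC i).card = (SA i).card + (SB i).card + (SC i).card := by
        rw [card_union_of_disjoint (disjoint_union_left.2 ⟨hdAC, hdBC⟩), card_union_of_disjoint hdAB]
      have h4 := card_le_univ (SA i ∪ SB i ∪ SC i)
      rw [Fintype.card_fin, h3] at h4
      exact h4
    have hT := hpair (A i) (C i) (SA i) (SC i) hsA hsC hbA hbC hdAC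
    have hE := hpair (A i) (B i) (SA i) (SB i) hsA hsB hbA hbB hdAB
    have hF := hpair (C i) (B i) (SC i) (SB i) hsC hsB hbC hbB hdBC.symm
    -- volume cap `V ≤ (2b+1)^s ≤ (x y²)^s`
    have hcapN : (A i).card * (B i).card * (C i).card ≤
        (2 * b + 1) ^ ((SA i).card + (SB i).card + (SC i).card) := by
      rw [pow_add, pow_add]
      exact Nat.mul_le_mul (Nat.mul_le_mul (card_le_pow_of_support (A i) (SA i) hsA hbA)
        (card_le_pow_of_support (B i) (SB i) hsB hbB))
        (card_le_pow_of_support (C i) (SC i) hsC hbC)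
    have hcapR : (((A i).card * (B i).card * (C i).card : ℕ) : ℝ) ≤
        (((2 * b + 1 : ℕ) : ℝ)) ^ ((SA i).card + (SB i).card + (SC i).card) := by
      exact_mod_cast hcapN
    have hcap : (((A i).card * (B i).card * (C i).card : ℕ) : ℝ) ≤
        (x * y ^ 2) ^ ((SA i).card + (SB i).card + (SC i).card) :=
      hcapR.trans (pow_le_pow_left₀ (by positivity) hxy _)
    have hkey := capacity_exponent_bookkeeping hx1 hy.le hs
    have hTnn : 0 ≤ ∑ u ∈ A i, ∑ v ∈ C i, coordPrice w (v - u) :=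
      sum_nonneg fun _ _ => sum_nonneg fun _ _ => prod_nonneg fun _ _ => hw _
    have hEnn : 0 ≤ ∑ u ∈ A i, ∑ v ∈ B i, coordPrice w (v - u) :=
      sum_nonneg fun _ _ => sum_nonneg fun _ _ => prod_nonneg fun _ _ => hw _
    exact capacity_cube_step (Nat.cast_nonneg _) (Nat.cast_nonneg _) (Nat.cast_nonneg _)
      (by positivity) (by positivity) (by positivity) (by push_cast; ring) (hcap.trans hkey) hT hE hF hTnn hEnn
  have key := volume_le_pow_of_coordPrice w hw b A B C hbox ⟨hoAB, hoAC, hoBC⟩ hPD hPE hPF hgeo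
  rw [hw_def, sum_coordPriceParam_Icc] at key
  exact_mod_cast key

/-- **Coordinate frames never fill the tile box**: `Σᵢ |Aᵢ||Bᵢ||Cᵢ| ≤ (4b+1)^D` (`x = 2b+1`, `y = 1`); in
particular `FrameNoExcess` holds for coordinate frame families in every box. [new, elementary] -/
theorem coordFrames_volume_le_four (D L b : ℕ) (A B C : Fin L → Finset (Fin D → ℤ))
    (SA SB SC : Fin L → Finset (Fin D))
    (hdisj : ∀ i, Disjoint (SA i) (SB i) ∧ Disjoint (SA i) (SC i) ∧ Disjoint (SB i) (SC i))
    (hsupp : ∀ i, (∀ v ∈ A i, ∀ t ∉ SA i, v t = 0) ∧ (∀ v ∈ B i, ∀ t ∉ SB i, v t = 0) ∧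
      (∀ v ∈ C i, ∀ t ∉ SC i, v t = 0))
    (hbox : ∀ i, (∀ v ∈ A i, ∀ t, |v t| ≤ (b : ℤ)) ∧ (∀ v ∈ B i, ∀ t, |v t| ≤ (b : ℤ)) ∧
      (∀ v ∈ C i, ∀ t, |v t| ≤ (b : ℤ)))
    (hPD : ∀ i k, ∀ x ∈ A i, ∀ z ∈ C i, ∀ x' ∈ A k, ∀ z' ∈ C k, z - x = z' - x' → i = k)
    (hPE : ∀ i k, ∀ x ∈ A i, ∀ y ∈ B i, ∀ x' ∈ A k, ∀ y' ∈ B k, y - x = y' - x' → i = k)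
    (hPF : ∀ i k, ∀ y ∈ B i, ∀ z ∈ C i, ∀ y' ∈ B k, ∀ z' ∈ C k, y - z = y' - z' → i = k) :
    ∑ i, (A i).card * (B i).card * (C i).card ≤ (4 * b + 1) ^ D := by
  have h := coordFrames_volume_le_param D L b (2 * b + 1) 1 A B C SA SB SC one_pos
    (by have : (0 : ℝ) ≤ b := Nat.cast_nonneg b; linarith) (by push_cast; nlinarith) hdisj hsupp hbox hPD hPE hPF
  have e : (2 * (b : ℝ) + 1 + 2 * (b : ℝ) * 1) = ((4 * b + 1 : ℕ) : ℝ) := by push_cast; ring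
  rw [e, ← Nat.cast_pow] at h
  exact_mod_cast h

/-- **The sharp constant, rational form**: `Σᵢ |Aᵢ||Bᵢ||Cᵢ| ≤ (189·b/50 + 16/25)^D = (3.78 b + 0.64)^D`
(`y = 5/4`, `x = 16(2b+1)/25`; the real optimum `3 b^{2/3}(2b+1)^{1/3}` is the CKSU USP capacity `3/2^{2/3}` times the
leg alphabet `2b`). [new, elementary] -/
theorem coordFrames_volume_le_sharp (D L b : ℕ) (A B C : Fin L → Finset (Fin D → ℤ))
    (SA SB SC : Fin L → Finset (Fin D))
    (hdisj : ∀ i, Disjoint (SA i) (SB i) ∧ Disjoint (SA i) (SC i) ∧ Disjoint (SB i) (SC i))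
    (hsupp : ∀ i, (∀ v ∈ A i, ∀ t ∉ SA i, v t = 0) ∧ (∀ v ∈ B i, ∀ t ∉ SB i, v t = 0) ∧
      (∀ v ∈ C i, ∀ t ∉ SC i, v t = 0))
    (hbox : ∀ i, (∀ v ∈ A i, ∀ t, |v t| ≤ (b : ℤ)) ∧ (∀ v ∈ B i, ∀ t, |v t| ≤ (b : ℤ)) ∧
      (∀ v ∈ C i, ∀ t, |v t| ≤ (b : ℤ)))
    (hPD : ∀ i k, ∀ x ∈ A i, ∀ z ∈ C i, ∀ x' ∈ A k, ∀ z' ∈ C k, z - x = z' - x' → i = k)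
    (hPE : ∀ i k, ∀ x ∈ A i, ∀ y ∈ B i, ∀ x' ∈ A k, ∀ y' ∈ B k, y - x = y' - x' → i = k)
    (hPF : ∀ i k, ∀ y ∈ B i, ∀ z ∈ C i, ∀ y' ∈ B k, ∀ z' ∈ C k, y - z = y' - z' → i = k) (hb : 1 ≤ b) :
    ((∑ i, (A i).card * (B i).card * (C i).card : ℕ) : ℝ) ≤ ((189 : ℝ) * b / 50 + 16 / 25) ^ D := by
  have hb1 : (1 : ℝ) ≤ b := by exact_mod_cast hb
  have h := coordFrames_volume_le_param D L b (16 * (2 * b + 1) / 25) (5 / 4) A B C SA SB SC (by norm_num)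
    (by linarith) (by push_cast; nlinarith) hdisj hsupp hbox hPD hPE hPF
  convert h using 2; ring

end CoordCapacity

end Summit.MatrixMultiplication.MatrixMultiplication.Theorems.ThinPackings.Negative
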